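/-
Copyright (c) 2026 the pub-hodgecm-mathlib formalisation cell (harness21).  Prover seat hodgecm-mathlib-R90-C131-p05 (g3), R90-TF SLAB section S4
«Ch13.1–2» (base R90-C131), h413 = `stmt-HodgeConjecture-24833`; brick (T-EQ-IMG) of the (B1) T-WIF spine (carve list R90-C131-p03 (g3) 2026-09-05T02:53:06Z (3);
S4 dealer K2E2-plan (g8) S4-R57 (2) 02:54:11Z).
-/
import Summits.HodgeConjecture.HodgeConjecture.Theorems.R90S4TwistedTubeTransversal     -- ★ p864410 (R90-C131-p03) (B1-T) part 1: `B₀`, `epsNorm_sheet`, `centralizer_coe_eq_of_isRegularElt`, `exists_mem_sheetTransversal_of_isEpsRegularAt`; brings ★ α `R90S4TwistedCartanNormFibres`, ★ `R90S4CartanNormMap`, ★ `R90S4TwistedNormMapLocal`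
import HarnessLib

/-!
# R90-TF · S4 «Ch. 13.1–2», T-WIF road, brick (T-EQ-IMG) `R90S4EpsNormTubeEqImage` — THE NORM TUBE OF A CARTAN IS THE IMAGE OF THE SHEETED TRANSVERSAL:
# `{δ ∈ G̃_v | ∃ t ∈ T^{reg}, t ∈ 𝒩(δ)} = Ψ(G̃_v∕T′ × B₀)` (Rogawski 1990, §12.5 p. 186; §3.11 Prop. 3.11.1 (b)(c) pp. 34–35)

Cell `hodgecm-mathlib`, crux H413 (`stmt-HodgeConjecture-24833`, lane `--supports … --as helper`), route of record `HCCMUnconditional` (no route verbs; count-neutral).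
Programme R90-TF, section S4 = [Rogawski1990] Ch. 13.1–13.2; seat R90-C131-p05 (g3); brick (T-EQ-IMG) of R90-C131-p03 (g3)'s carve list (R90 bus 2026-09-05T02:53:06Z (3)),
dealt S4-R57 (2): «the glue between ★ p864343 `R90S4EpsRegularStablePartition`'s tubes and my `Ψ '' D`», consumed BY NAME in the (B1-Σ) assembly.  THEOREMS ONLY — no
`def`, no instance, no notation, no named-fact hypothesis, no `sorry`; default heartbeats; ★-only imports.

HONEST LABEL: HC_CM is proved only modulo the 7 printed citations (2 remaining named inputs: hLiu418 = stmt-HodgeConjecture-24832, h413 = stmt-HodgeConjecture-24833) until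
rung 0 closes.  Group algebra at the S4 carriers over ★ part 1's letters (the norm section `s` and the `K_T`-representatives `R` are HYPOTHESES, as there); discharges no
socket; REL ≠ ★ ≠ BUILT.

## The mathematics

SETTING = ★ part 1 ∕ 2a (`R90S4TwistedTubeTransversal`, `R90S4TwistedTubeFibres`): `G_v = U(Φ₃)(L⁺_v)`, `G̃_v = GtLoc L v`, `ε = ε_v` at `Φ₃ = splitFormGL L` (hermitian, so
`ε ∘ ε = 1`), `T = Z_{G_v}(γ₀)` (`γ₀` regular), `T̃ = Cent_{G̃_v}(γ₀)`, `N δ = δ ε(δ)`, `s : T → T̃` a norm section (`N(s t) = t`), `R` representatives of `T̃ᴺ ∕ (1−ε)T̃`,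
`B₀ = {s(t)·u | t ∈ T^{reg}, u ∈ R} ⊆ T̃` the sheeted transversal, `Ψ(x T′, b) = x b ε(x)⁻¹` the ε-twisted tube map on `(G̃_v ∕ T′) × T̃` (`T′ = G̃_{δ₀ε}`), `D = {p | p.2 ∈ B₀}`,
and «`t ∈ 𝒩(δ)`» = ★ `IsEpsNormPair L Φ₃ v δ t` (`N δ` is `G̃_v`-conjugate to `t`).
* `⊇` (`isEpsNormPair_epsTube_sheet`): `N(Ψ(xT′, s(t) u)) = x · N(s(t) u) · x⁻¹ = x t x⁻¹` (★ `epsNorm_epsLoc_mul_mul_inv`, ★ part 1 `epsNorm_sheet`), conjugate to `t`.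
* `⊆` (`exists_epsTube_eq_of_isEpsNormPair`): if `t ∈ 𝒩(δ)` with `t ∈ T` regular, ε-conjugate `δ` to `δ₁ = c δ ε(c)⁻¹` with `N δ₁ = t` ON THE NOSE (★ α
  `exists_isEpsConj_epsNorm_eq_coe_of_isEpsNormPair`); then `δ₁ ∈ Cent(t) = T̃` (★ α `mem_centralizer_of_epsNorm_eq_coe` — `ε(N δ₁) = δ₁⁻¹ (N δ₁) δ₁` and `ε t = t` — with
  ★ part 1 `centralizer_coe_eq_of_isRegularElt`) and `δ₁` is ε-regular, so ★ part 1 `exists_mem_sheetTransversal_of_isEpsRegularAt` gives `b₀ ∈ B₀`, `a ∈ T̃` with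
  `b₀ = δ₁ · a ε(a)⁻¹ = a δ₁ ε(a)⁻¹` (`T̃` abelian); hence `δ = Ψ((a c)⁻¹ T′, b₀)`.
* THE HEAD (`setOf_exists_isEpsNormPair_eq_image_epsTube`): **`{δ | ∃ t : T, t regular ∧ t ∈ 𝒩(δ)} = Ψ '' D`** — print's «every regular ε-semisimple `δ` whose norm class
  meets `T` is ε-conjugate into `T̃` over a point of the transversal» [§12.5 p. 186], i.e. the ε-regular norm tube over `T` IS the twisted tube swept out from `B₀`.

[cite: Rogawski1990, §12.5 p. 186; §3.11 Prop. 3.11.1 (b)(c), Prop. 3.11.2 pp. 34–35]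
-/

set_option autoImplicit false
-- the mandated namespace repeats the single-problem summit's segment (`HodgeConjecture.HodgeConjecture`)
set_option linter.dupNamespace false

noncomputable section

open Set Function NumberField IsDedekindDomain
open scoped MatrixGroups Pointwise

namespace Summit.HodgeConjecture.HodgeConjecture.R90.S4

open Literature.NumberTheory.Rogawski1990 Literature.NumberTheory.Rogawski1990.Ch4Sec10
open Literature.NumberTheory.Automorphic Literature.NumberTheory.Automorphic.UnitaryGroup

section NormTube

variable {L : Type} [Field L] [NumberField L] [IsCMField L] {v : HeightOneSpectrum (𝓞 ↥(maximalRealSubfield L))}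
  {T : Subgroup ((UnitaryGroup.cmDatum L 3 (splitFormGL L : Matrix (Fin 3) (Fin 3) L)).Local v)}
  {γ₀ : (UnitaryGroup.cmDatum L 3 (splitFormGL L : Matrix (Fin 3) (Fin 3) L)).Local v} (hγ₀ : IsRegularElt (γ₀.val : GtLoc L v))
  (hT : T = Subgroup.centralizer ({γ₀} : Set ((UnitaryGroup.cmDatum L 3 (splitFormGL L : Matrix (Fin 3) (Fin 3) L)).Local v)))
  {δ₀ : GtLoc L v}
  (Ψ : (GtLoc L v ⧸ epsCentralizer (epsLoc L (splitFormGL L) v) δ₀) × ↥(Subgroup.centralizer ({(γ₀.val : GtLoc L v)} : Set (GtLoc L v))) → GtLoc L v)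
  (hΨ : ∀ (x : GtLoc L v) (b : ↥(Subgroup.centralizer ({(γ₀.val : GtLoc L v)} : Set (GtLoc L v)))), Ψ (QuotientGroup.mk x, b) = x * b * (epsLoc L (splitFormGL L) v x)⁻¹)
  (s : ↥T → ↥(Subgroup.centralizer ({(γ₀.val : GtLoc L v)} : Set (GtLoc L v))))
  (hsN : ∀ t : ↥T, epsNorm (epsLoc L (splitFormGL L) v) (s t : GtLoc L v) = ((t : (UnitaryGroup.cmDatum L 3 (splitFormGL L : Matrix (Fin 3) (Fin 3) L)).Local v)).val)
  (R : Finset ↥(Subgroup.centralizer ({(γ₀.val : GtLoc L v)} : Set (GtLoc L v))))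
  (hRN : ∀ u ∈ R, epsNorm (epsLoc L (splitFormGL L) v) (u : GtLoc L v) = 1)
  (hRcov : ∀ w : ↥(Subgroup.centralizer ({(γ₀.val : GtLoc L v)} : Set (GtLoc L v))), epsNorm (epsLoc L (splitFormGL L) v) (w : GtLoc L v) = 1 →
    ∃ u ∈ R, ∃ a : ↥(Subgroup.centralizer ({(γ₀.val : GtLoc L v)} : Set (GtLoc L v))), (w : GtLoc L v) = u * (a * (epsLoc L (splitFormGL L) v a)⁻¹))

/-! ## §1 `⊇`: the twisted tube over a sheet point `s(t) u` lies in the norm tube over `t` -/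

include hγ₀ hΨ hsN hRN in
/-- **`N(Ψ(x T′, s(t) u)) = x · t · x⁻¹`**: the norm of a tube point over the sheet point `s(t) u` (`u ∈ R`) is the conjugate of `t` by the fibre coordinate
(★ `epsNorm_epsLoc_mul_mul_inv`: `N(x b ε(x)⁻¹) = x (N b) x⁻¹`; ★ part 1 `epsNorm_sheet`: `N(s(t) u) = t`). [cite: Rogawski1990, §12.5 p. 186; §3.11 p. 34] -/
theorem epsNorm_epsTube_sheet (x : GtLoc L v) (t : ↥T) (u : ↥(Subgroup.centralizer ({(γ₀.val : GtLoc L v)} : Set (GtLoc L v)))) (hu : u ∈ R) :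
    epsNorm (epsLoc L (splitFormGL L) v) (Ψ (QuotientGroup.mk x, s t * u)) =
      x * ((t : (UnitaryGroup.cmDatum L 3 (splitFormGL L : Matrix (Fin 3) (Fin 3) L)).Local v)).val * x⁻¹ := by
  rw [hΨ, epsNorm_epsLoc_mul_mul_inv (splitFormGL_isHermitian L) x, epsNorm_sheet hγ₀ s hsN R hRN t u hu]

include hγ₀ hΨ hsN hRN in
/-- **`⊇` POINTWISE — `t ∈ 𝒩(Ψ(x T′, s(t) u))`** for `t ∈ T`, `u ∈ R`, any fibre coordinate `x`: the norm `x t x⁻¹` is conjugate to `t`. [cite: Rogawski1990, §12.5 p. 186; §3.11 Prop. 3.11.1 (c) p. 34] -/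
theorem isEpsNormPair_epsTube_sheet (x : GtLoc L v) (t : ↥T) (u : ↥(Subgroup.centralizer ({(γ₀.val : GtLoc L v)} : Set (GtLoc L v)))) (hu : u ∈ R) :
    IsEpsNormPair L (splitFormGL L) v (Ψ (QuotientGroup.mk x, s t * u)) (t : (UnitaryGroup.cmDatum L 3 (splitFormGL L : Matrix (Fin 3) (Fin 3) L)).Local v) := by
  rw [isEpsNormPair_iff, epsNorm_epsTube_sheet hγ₀ Ψ hΨ s hsN R hRN x t u hu]
  exact isConj_iff.2 ⟨x⁻¹, by group⟩

/-! ## §2 `⊆`: a `δ` whose norm class meets `T^{reg}` is a tube point over `B₀` -/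

include hγ₀ hT hΨ hsN hRcov in
/-- **`⊆` POINTWISE — if `t ∈ 𝒩(δ)` for a regular `t ∈ T` then `δ = Ψ(x T′, b₀)` for some `b₀ ∈ B₀`**: ε-conjugate `δ` to `δ₁ = c δ ε(c)⁻¹` with `N δ₁ = t` exactly (★ α
`exists_isEpsConj_epsNorm_eq_coe_of_isEpsNormPair`), so `δ₁ ∈ Cent(t) = T̃` is ε-regular (★ α `mem_centralizer_of_epsNorm_eq_coe`, ★ part 1 `centralizer_coe_eq_of_isRegularElt`);
★ part 1 `exists_mem_sheetTransversal_of_isEpsRegularAt` gives `b₀ = δ₁ · a ε(a)⁻¹ ∈ B₀` with `a ∈ T̃`, and `T̃` abelian gives `δ = (a c)⁻¹ · b₀ · ε((a c)⁻¹)⁻¹`.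
[cite: Rogawski1990, §12.5 p. 186; §3.11 Prop. 3.11.1 (b)(c), Prop. 3.11.2 pp. 34–35] -/
theorem exists_epsTube_eq_of_isEpsNormPair {δ : GtLoc L v} (t : ↥T)
    (ht : IsRegularElt (((t : (UnitaryGroup.cmDatum L 3 (splitFormGL L : Matrix (Fin 3) (Fin 3) L)).Local v)).val : GtLoc L v))
    (hδ : IsEpsNormPair L (splitFormGL L) v δ (t : (UnitaryGroup.cmDatum L 3 (splitFormGL L : Matrix (Fin 3) (Fin 3) L)).Local v)) :
    ∃ x : GtLoc L v, ∃ b₀ ∈ {b : ↥(Subgroup.centralizer ({(γ₀.val : GtLoc L v)} : Set (GtLoc L v))) |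
        ∃ t : ↥T, IsRegularElt (((t : (UnitaryGroup.cmDatum L 3 (splitFormGL L : Matrix (Fin 3) (Fin 3) L)).Local v)).val : GtLoc L v) ∧ ∃ u ∈ R, b = s t * u},
      Ψ (QuotientGroup.mk x, b₀) = δ := by
  have hΦ := splitFormGL_isHermitian L
  -- ε-conjugate `δ` into the norm fibre over `t`: `N δ₁ = t` on the nose
  obtain ⟨δ₁, ⟨c, hc⟩, hN₁⟩ := exists_isEpsConj_epsNorm_eq_coe_of_isEpsNormPair hΦ hδ
  -- so `δ₁ ∈ Cent(t) = T̃`, ε-regular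
  have hδ₁T : δ₁ ∈ Subgroup.centralizer ({(γ₀.val : GtLoc L v)} : Set (GtLoc L v)) := by
    rw [← centralizer_coe_eq_of_isRegularElt hγ₀ hT t ht]
    exact mem_centralizer_of_epsNorm_eq_coe hΦ hN₁
  have hreg : IsEpsRegularAt L (splitFormGL L) v δ₁ := isEpsRegularAt_of_epsNorm_eq_coe ht hN₁
  -- a `(1−ε)T̃`-translate of `δ₁` lies in `B₀`
  obtain ⟨b₀, hb₀, a, ha, hb₀eq⟩ := exists_mem_sheetTransversal_of_isEpsRegularAt hγ₀ hT s hsN R hRcov ⟨δ₁, hδ₁T⟩ hreg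
  have hcomm : a * δ₁ = δ₁ * a := mul_comm_of_mem_centralizer_of_isRegularElt hγ₀ ha hδ₁T
  refine ⟨c⁻¹ * a⁻¹, b₀, hb₀, ?_⟩
  rw [hΨ, hb₀eq, map_mul, map_inv, map_inv]
  change c⁻¹ * a⁻¹ * (δ₁ * (a * (epsLoc L (splitFormGL L) v a)⁻¹)) *
      ((epsLoc L (splitFormGL L) v c)⁻¹ * (epsLoc L (splitFormGL L) v a)⁻¹)⁻¹ = δ
  calc c⁻¹ * a⁻¹ * (δ₁ * (a * (epsLoc L (splitFormGL L) v a)⁻¹)) * ((epsLoc L (splitFormGL L) v c)⁻¹ * (epsLoc L (splitFormGL L) v a)⁻¹)⁻¹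
      = c⁻¹ * (a⁻¹ * (δ₁ * a)) * epsLoc L (splitFormGL L) v c := by group
    _ = c⁻¹ * (a⁻¹ * (a * δ₁)) * epsLoc L (splitFormGL L) v c := by rw [hcomm]
    _ = c⁻¹ * (c * δ * (epsLoc L (splitFormGL L) v c)⁻¹) * epsLoc L (splitFormGL L) v c := by rw [inv_mul_cancel_left, hc]
    _ = δ := by group

/-! ## §3 The head: the norm tube over `T^{reg}` is the image of `D = (G̃_v ∕ T′) × B₀` -/

include hγ₀ hT hΨ hsN hRN hRcov in
/-- **(T-EQ-IMG) THE NORM TUBE OF `T` IS THE IMAGE OF THE SHEETED TRANSVERSAL — `{δ | ∃ t : T, t regular ∧ t ∈ 𝒩(δ)} = Ψ '' {p | p.2 ∈ B₀}`**: the ε-twisted tube swept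
out from `B₀` (★ part 1∕2a's `Ψ '' D`) is EXACTLY the set of `δ ∈ G̃_v` whose norm class meets `T^{reg}` (★ p864343 `R90S4EpsRegularStablePartition`'s tube over `T`) — §1 gives `⊇`,
§2 gives `⊆`. [cite: Rogawski1990, §12.5 p. 186; §3.11 Prop. 3.11.1 (b)(c), Prop. 3.11.2 pp. 34–35] -/
theorem setOf_exists_isEpsNormPair_eq_image_epsTube :
    {δ : GtLoc L v | ∃ t : ↥T, IsRegularElt (((t : (UnitaryGroup.cmDatum L 3 (splitFormGL L : Matrix (Fin 3) (Fin 3) L)).Local v)).val : GtLoc L v) ∧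
        IsEpsNormPair L (splitFormGL L) v δ (t : (UnitaryGroup.cmDatum L 3 (splitFormGL L : Matrix (Fin 3) (Fin 3) L)).Local v)} =
      Ψ '' {p | p.2 ∈ {b : ↥(Subgroup.centralizer ({(γ₀.val : GtLoc L v)} : Set (GtLoc L v))) |
        ∃ t : ↥T, IsRegularElt (((t : (UnitaryGroup.cmDatum L 3 (splitFormGL L : Matrix (Fin 3) (Fin 3) L)).Local v)).val : GtLoc L v) ∧ ∃ u ∈ R, b = s t * u}} := by
  refine Set.Subset.antisymm ?_ ?_
  · rintro δ ⟨t, ht, hδ⟩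
    obtain ⟨x, b₀, hb₀, hx⟩ := exists_epsTube_eq_of_isEpsNormPair hγ₀ hT Ψ hΨ s hsN R hRcov t ht hδ
    exact ⟨(QuotientGroup.mk x, b₀), hb₀, hx⟩
  · rintro δ ⟨p, hp, rfl⟩
    obtain ⟨q, b⟩ := p
    obtain ⟨t, ht, u, hu, hbeq⟩ := hp
    dsimp only at hbeq
    subst hbeq
    induction q using QuotientGroup.induction_on with
    | H x => exact ⟨t, ht, isEpsNormPair_epsTube_sheet hγ₀ Ψ hΨ s hsN R hRN x t u hu⟩

end NormTube

end Summit.HodgeConjecture.HodgeConjecture.R90.S4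

end
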